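import Summits.Schanuel.Schanuel.Theorems.ZilberEacLaurentGraphExample
import Summits.Schanuel.Schanuel.Theorems.ZilberEacParamRamifiedChart
import HarnessLib

/-!
# Arbitrary base branches, XII: an INFINITE FAMILY over rational curves with two places at
# infinity — `{x₀x₁ = P(x₀), y₀ = x₁ − (P(x₀) − P(0))/x₀ + θ}` is in the case AND dense

HONEST FRAMING.  Cell `pub-schanuel` (Zilber's Exponential-Algebraic Closedness, case ladder;
host summit Schanuel), seat 2, gen 28.  File X decided one surface over the Laurent graph
`x₁ = x₀² + 1/x₀`.  Here: for EVERY polynomial `P` of degree `n ≥ 3` with `P(0) ≠ 0` and every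
`θ ≠ 0`, over the base curve `C_P : x₀x₁ = P(x₀)` — the graph of the Laurent polynomial `P(x₀)/x₀`,
a rational curve with two places at infinity, hence neither a polynomial graph nor polynomially
parametrised — the surface
  `S(P, θ) = {x₀x₁ − P(x₀) = 0, y₀ = x₁ − Q(x₀) + θ}`, `Q = (P − P(0))/X` (so `y₀ = θ + P(0)/x₀` on `C_P`),
is in Mantova–Masser's case (dim-π-S-1-free) AND has Zariski-dense exponential points
(**`unprojectedDensityQuestion_laurentGraphFamily`**).  Branch at the place `x₀ → ∞`:
`x₀ = 1/s`, `x₁ = s·P(1/s) = Φ(s)s^{-(n-1)}` with `Φ(0) = lc(P)` (`k = 1 < M = n − 1`),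
`y₀ = θ + P(0)s`; fibre relation `x₀y₀ − θx₀ − P(0)` (zero over `x₀ = −P(0)/θ`); the curve is not a
line because `m₀X² + m₁P − cX` cannot vanish identically for `m ≠ 0`.  Decided instances of an OPEN
question (Mantova–Masser, PLMS 2024 §1 p. 5); EC(3,2) OPEN; NOT Schanuel's conjecture (neither used
nor implied); EAC ⇏ SC.
-/

noncomputable section

open Filter Topology Set Complex MvPolynomial
open Literature.NumberTheory.Transcendental Literature.ModelTheory.Zilber
open Literature.ModelTheory.ExponentialFields

set_option linter.dupNamespace false

namespace Summit.Schanuel.Schanuel.Theorems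

section Family

variable (P : Polynomial ℂ) (θ : ℂ)

/-- `C(p₀) · C(p₀)⁻¹ = 1` in `ℂ[X]` for `p₀ ≠ 0`. -/
theorem C_mul_C_inv_of_ne_zero {c : ℂ} (hc : c ≠ 0) :
    Polynomial.C c * Polynomial.C c⁻¹ = (1 : Polynomial ℂ) := by
  rw [← Polynomial.C_mul, mul_inv_cancel₀ hc, Polynomial.C_1]

/-- The base relation `x₀·t − P(x₀)` is irreducible in `ℂ[s][t]` when `P(0) ≠ 0`. [folklore] -/
theorem irreducible_laurentFamily_baseRow (h0 : P.coeff 0 ≠ 0) :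
    Irreducible (Polynomial.C (Polynomial.X : Polynomial ℂ) * Polynomial.X +
      Polynomial.C (-P : Polynomial ℂ)) := by
  refine irreducible_C_mul_X_add_C_of_isCoprime Polynomial.X_ne_zero ?_
  have h := Polynomial.divX_mul_X_add P
  have hC := C_mul_C_inv_of_ne_zero h0
  exact ⟨-(Polynomial.divX P * Polynomial.C (P.coeff 0)⁻¹), -Polynomial.C (P.coeff 0)⁻¹,
    by linear_combination (-(Polynomial.C (P.coeff 0)⁻¹)) * h + hC⟩

/-- The fibre relation `x₀·t − (θx₀ + P(0))` is irreducible in `ℂ[s][t]` when `P(0) ≠ 0`. [folklore] -/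
theorem irreducible_laurentFamily_fibreRow (h0 : P.coeff 0 ≠ 0) :
    Irreducible (Polynomial.C (Polynomial.X : Polynomial ℂ) * Polynomial.X +
      Polynomial.C (-(Polynomial.C θ * Polynomial.X + Polynomial.C (P.coeff 0)) : Polynomial ℂ)) := by
  refine irreducible_C_mul_X_add_C_of_isCoprime Polynomial.X_ne_zero ?_
  have hC := C_mul_C_inv_of_ne_zero h0
  exact ⟨-(Polynomial.C θ * Polynomial.C (P.coeff 0)⁻¹), -Polynomial.C (P.coeff 0)⁻¹,
    by linear_combination hC⟩

/-- Evaluation of the base polynomial `x₀x₁ − P(x₀)`. -/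
theorem eval_laurentFamily_baseMv (x : Fin 2 → ℂ) :
    MvPolynomial.eval x (X 0 * X 1 - Polynomial.aeval (X 0 : MvPolynomial (Fin 2) ℂ) P) =
      x 0 * x 1 - P.eval (x 0) := by
  rw [map_sub, map_mul, MvPolynomial.eval_X, MvPolynomial.eval_X, eval_polynomial_aeval_X]

/-- Evaluation of the fibre function `x₁ − Q(x₀) + θ`. -/
theorem eval_laurentFamily_fibreMv (x : Fin 2 → ℂ) :
    MvPolynomial.eval x (X 1 - Polynomial.aeval (X 0 : MvPolynomial (Fin 2) ℂ) (Polynomial.divX P) +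
        MvPolynomial.C θ) = x 1 - (Polynomial.divX P).eval (x 0) + θ := by
  rw [map_add, map_sub, MvPolynomial.eval_X, eval_polynomial_aeval_X, MvPolynomial.eval_C]

/-- The base polynomial and its rows. -/
theorem eval_laurentFamily_baseMv_rows (x y : ℂ) :
    MvPolynomial.eval ![x, y] (X 0 * X 1 - Polynomial.aeval (X 0 : MvPolynomial (Fin 2) ℂ) P) =
      ((Polynomial.C (Polynomial.X : Polynomial ℂ) * Polynomial.X +
        Polynomial.C (-P : Polynomial ℂ)).map (Polynomial.evalRingHom x)).eval y := by
  rw [evalPP_linear, eval_laurentFamily_baseMv]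
  simp
  ring

/-- The base polynomial `x₀x₁ − P(x₀)` is irreducible in `ℂ[x₀, x₁]` (`P(0) ≠ 0`). [folklore] -/
theorem irreducible_laurentFamily_baseMv (h0 : P.coeff 0 ≠ 0) :
    Irreducible (X 0 * X 1 - Polynomial.aeval (X 0 : MvPolynomial (Fin 2) ℂ) P) :=
  (irreducible_rows_iff (eval_laurentFamily_baseMv_rows P)).2 (irreducible_laurentFamily_baseRow P h0)

/-- **Density for the whole family.**  `deg P ≥ 3`, `P(0) ≠ 0`, `θ ≠ 0` ⟹
`{x₀x₁ − P(x₀) = 0, y₀ = x₁ − Q(x₀) + θ}` has Zariski-dense exponential points.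
[cite: MantovaMasser2023, §1 Further remarks, p. 5 (the question, open in general)] (new) -/
theorem unprojectedDense_laurentGraphFamily (hn : 3 ≤ P.natDegree) (h0 : P.coeff 0 ≠ 0)
    (hθ : θ ≠ 0) :
    UnprojectedDense {w : Fin 2 ⊕ Fin 2 → ℂ |
      MvPolynomial.eval ![w (Sum.inl 0), w (Sum.inl 1)]
        (X 0 * X 1 - Polynomial.aeval (X 0 : MvPolynomial (Fin 2) ℂ) P) = 0 ∧
      w (Sum.inr 0) = MvPolynomial.eval ![w (Sum.inl 0), w (Sum.inl 1)]
        (X 1 - Polynomial.aeval (X 0 : MvPolynomial (Fin 2) ℂ) (Polynomial.divX P) +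
          MvPolynomial.C θ)} := by
  have hP0 : P ≠ 0 := fun h => by rw [h, Polynomial.natDegree_zero] at hn; omega
  have hirrMv := irreducible_laurentFamily_baseMv P h0
  have hS := isIrreducibleClosed_curveGraphFibre
    (X 1 - Polynomial.aeval (X 0 : MvPolynomial (Fin 2) ℂ) (Polynomial.divX P) + MvPolynomial.C θ)
    hirrMv
  have hdim := zariskiDim_curveGraphFibre
    (X 1 - Polynomial.aeval (X 0 : MvPolynomial (Fin 2) ℂ) (Polynomial.divX P) + MvPolynomial.C θ)
    hirrMv
  set n := P.natDegree with hndef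
  set c₀ := P.coeff 0 with hc₀
  set Arow : Polynomial (Polynomial ℂ) := Polynomial.C (Polynomial.X : Polynomial ℂ) * Polynomial.X +
      Polynomial.C (-P : Polynomial ℂ) with hArow
  set Frow : Polynomial (Polynomial ℂ) := Polynomial.C (Polynomial.X : Polynomial ℂ) * Polynomial.X +
      Polynomial.C (-(Polynomial.C θ * Polynomial.X + Polynomial.C c₀) : Polynomial ℂ) with hFrow
  have hAirr : Irreducible Arow := irreducible_laurentFamily_baseRow P h0
  have hFirr : Irreducible Frow := irreducible_laurentFamily_fibreRow P θ h0
  have hA1 : Arow.natDegree ≠ 0 := by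
    rw [hArow, Polynomial.natDegree_linear Polynomial.X_ne_zero]; exact one_ne_zero
  have hF1 : Frow.natDegree ≠ 0 := by
    rw [hFrow, Polynomial.natDegree_linear Polynomial.X_ne_zero]; exact one_ne_zero
  have hFcoeff0 : Frow.coeff 0 = -(Polynomial.C θ * Polynomial.X + Polynomial.C c₀) := by
    rw [hFrow, Polynomial.coeff_add, Polynomial.coeff_C_mul_X, Polynomial.coeff_C_zero]
    simp
  have hF00 : Frow.coeff 0 ≠ 0 := by
    rw [hFcoeff0, neg_ne_zero]
    intro h
    have := congrArg (Polynomial.eval (0 : ℂ)) h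
    simp at this
    exact h0 this
  have ha : (Frow.coeff 0).IsRoot (-c₀ / θ) := by
    rw [hFcoeff0]
    simp only [Polynomial.IsRoot, Polynomial.eval_neg, Polynomial.eval_add, Polynomial.eval_mul,
      Polynomial.eval_C, Polynomial.eval_X]
    field_simp
    ring
  have hAeval : ∀ x y : ℂ, (Arow.map (Polynomial.evalRingHom x)).eval y = x * y - P.eval x := by
    intro x y; rw [hArow, evalPP_linear]; simp; ring
  have hFeval : ∀ x y : ℂ, (Frow.map (Polynomial.evalRingHom x)).eval y = x * y - (θ * x + c₀) := by
    intro x y; rw [hFrow, evalPP_linear]; simp; ring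
  -- the branch `x₀ = 1/s`, `x₁ = s P(1/s) = Φ(s) s^{-(n-1)}`, `y₀ = θ + c₀ s`
  obtain ⟨Φ, hΦan, hΦ0eq, hΦeval⟩ :=
    exists_polarForm_eval P (U := fun _ : ℂ => (1 : ℂ)) analyticAt_const (k := 1) le_rfl
  have hΦ0 : Φ 0 ≠ 0 := by
    rw [hΦ0eq, one_pow, mul_one]
    exact Polynomial.leadingCoeff_ne_zero.2 hP0
  have hPeval : ∀ s : ℂ, s ≠ 0 → P.eval s⁻¹ = Φ s * s⁻¹ ^ n := by
    intro s hs
    have h := hΦeval s hs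
    rw [one_mul, pow_one, one_mul] at h
    exact h
  set ψ : ℂ → ℂ := fun s => θ + c₀ * s with hψ
  have hψan : AnalyticAt ℂ ψ 0 := analyticAt_const.add (analyticAt_const.mul analyticAt_id)
  have hψ0 : ψ 0 = θ := by simp [hψ]
  have hn1 : 1 + 1 ≤ n - 1 := by omega
  have hpow : ∀ s : ℂ, s ≠ 0 → s⁻¹ * (Φ s * (s ^ (n - 1))⁻¹) = Φ s * s⁻¹ ^ n := by
    intro s hs
    have e : n = (n - 1) + 1 := by omega
    rw [inv_pow, e, pow_succ, mul_inv, Nat.add_sub_cancel]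
    ring
  -- `Q(1/s) = s (P(1/s) − c₀)`
  have hQ : ∀ s : ℂ, s ≠ 0 → (Polynomial.divX P).eval s⁻¹ = s * (P.eval s⁻¹ - c₀) := by
    intro s hs
    have h := congrArg (Polynomial.eval s⁻¹) (Polynomial.divX_mul_X_add P)
    rw [Polynomial.eval_add, Polynomial.eval_mul, Polynomial.eval_X, Polynomial.eval_C] at h
    rw [← h]
    field_simp
    ring
  have hbranch : ∀ᶠ s in 𝓝[≠] (0 : ℂ),
      (Frow.map (Polynomial.evalRingHom (s ^ 1)⁻¹)).eval (ψ s) = 0 := by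
    filter_upwards [self_mem_nhdsWithin] with s (hs : s ≠ 0)
    rw [hFeval, pow_one, hψ]
    field_simp
    ring
  have hbase : ∀ᶠ s in 𝓝[≠] (0 : ℂ),
      (Arow.map (Polynomial.evalRingHom (s ^ 1)⁻¹)).eval (Φ s * (s ^ (n - 1))⁻¹) = 0 := by
    filter_upwards [self_mem_nhdsWithin] with s (hs : s ≠ 0)
    rw [hAeval, pow_one, hpow s hs, hPeval s hs, sub_self]
  have hgerm : ∀ᶠ s in 𝓝[≠] (0 : ℂ),
      (Sum.elim ![(s ^ 1)⁻¹, Φ s * (s ^ (n - 1))⁻¹] ![ψ s, Complex.exp (Φ s * (s ^ (n - 1))⁻¹)] :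
        Fin 2 ⊕ Fin 2 → ℂ) ∈ {w : Fin 2 ⊕ Fin 2 → ℂ |
      MvPolynomial.eval ![w (Sum.inl 0), w (Sum.inl 1)]
        (X 0 * X 1 - Polynomial.aeval (X 0 : MvPolynomial (Fin 2) ℂ) P) = 0 ∧
      w (Sum.inr 0) = MvPolynomial.eval ![w (Sum.inl 0), w (Sum.inl 1)]
        (X 1 - Polynomial.aeval (X 0 : MvPolynomial (Fin 2) ℂ) (Polynomial.divX P) +
          MvPolynomial.C θ)} := by
    filter_upwards [self_mem_nhdsWithin, hbase] with s (hs : s ≠ 0) hA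
    refine ⟨?_, ?_⟩
    · simp only [Sum.elim_inl, Matrix.cons_val_zero, Matrix.cons_val_one]
      rw [eval_laurentFamily_baseMv_rows]
      exact hA
    · simp only [Sum.elim_inr, Sum.elim_inl, Matrix.cons_val_zero, Matrix.cons_val_one]
      rw [eval_laurentFamily_fibreMv]
      simp only [Matrix.cons_val_one, Matrix.cons_val_zero, pow_one, hψ]
      rw [hQ s hs, hPeval s hs, ← hpow s hs]
      field_simp
      ring
  obtain ⟨e, η, he, hηan, hη0, hηne, hFη⟩ := exists_zeroBranch_puiseux Frow hFirr hF1 hF00 ha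
  exact unprojectedDense_branch_cycle_zeroBranch hS (le_of_eq hdim) Frow hFirr hF1 Arow hAirr hA1
    (le_refl 1) hn1 hψan hθ hψ0 hΦan hΦ0 hbranch hbase hgerm
    (analyticAt_const.add (analyticAt_id.pow e)) hηan hη0 (deriv_newtonBase_ne_zero _ he) hηne hFη

/-- **The family is in Mantova–Masser's case (dim-π-S-1-free)** (for every `θ`; `deg P ≥ 3`,
`P(0) ≠ 0`). (new) -/
theorem mmCase_laurentGraphFamily (hn : 3 ≤ P.natDegree) (h0 : P.coeff 0 ≠ 0) :
    MMCaseDimPiOneFree {w : Fin 2 ⊕ Fin 2 → ℂ |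
      MvPolynomial.eval ![w (Sum.inl 0), w (Sum.inl 1)]
        (X 0 * X 1 - Polynomial.aeval (X 0 : MvPolynomial (Fin 2) ℂ) P) = 0 ∧
      w (Sum.inr 0) = MvPolynomial.eval ![w (Sum.inl 0), w (Sum.inl 1)]
        (X 1 - Polynomial.aeval (X 0 : MvPolynomial (Fin 2) ℂ) (Polynomial.divX P) +
          MvPolynomial.C θ)} := by
  set c₀ := P.coeff 0 with hc₀
  have hlc : P.leadingCoeff ≠ 0 :=
    Polynomial.leadingCoeff_ne_zero.2 (fun h => by rw [h, Polynomial.natDegree_zero] at hn; omega)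
  -- the value of `R` at the point of `C_P` over `x₀ ≠ 0` is `θ + c₀/x₀`
  have hRval : ∀ x₀ : ℂ, x₀ ≠ 0 →
      MvPolynomial.eval ![x₀, P.eval x₀ / x₀]
        (X 1 - Polynomial.aeval (X 0 : MvPolynomial (Fin 2) ℂ) (Polynomial.divX P) +
          MvPolynomial.C θ) = θ + c₀ / x₀ := by
    intro x₀ hx
    rw [eval_laurentFamily_fibreMv]
    simp only [Matrix.cons_val_one, Matrix.cons_val_zero]
    have h := congrArg (Polynomial.eval x₀) (Polynomial.divX_mul_X_add P)
    rw [Polynomial.eval_add, Polynomial.eval_mul, Polynomial.eval_X, Polynomial.eval_C] at h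
    rw [← h]
    field_simp
    ring
  have hAval : ∀ x₀ : ℂ, x₀ ≠ 0 →
      MvPolynomial.eval ![x₀, P.eval x₀ / x₀]
        (X 0 * X 1 - Polynomial.aeval (X 0 : MvPolynomial (Fin 2) ℂ) P) = 0 := by
    intro x₀ hx
    rw [eval_laurentFamily_baseMv]
    simp only [Matrix.cons_val_zero, Matrix.cons_val_one]
    field_simp
    ring
  refine mmCase_curveGraphFibre (irreducible_laurentFamily_baseMv P h0) ?_ ?_
  · -- a point of `C_P` with `R ≠ 0`: `x₀ = 1` unless `θ + c₀ = 0`, then `x₀ = 2`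
    by_cases h1 : θ + c₀ ≠ 0
    · exact ⟨![1, P.eval 1 / 1], hAval 1 one_ne_zero, by rw [hRval 1 one_ne_zero, div_one]; exact h1⟩
    · push Not at h1
      refine ⟨![2, P.eval 2 / 2], hAval 2 two_ne_zero, ?_⟩
      rw [hRval 2 two_ne_zero]
      have : θ = -c₀ := by linear_combination h1
      rw [this]
      intro h
      apply h0
      linear_combination (-2 : ℂ) * h
  · -- `C_P` is not contained in a line: `m₀X² + m₁P − cX` would vanish identically
    intro m hm c
    by_contra hcon
    push Not at hcon
    set G : Polynomial ℂ := Polynomial.C (m 0 : ℂ) * Polynomial.X ^ 2 + Polynomial.C (m 1 : ℂ) * P -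
      Polynomial.C c * Polynomial.X with hG
    have hGroot : ∀ x₀ : ℂ, x₀ ≠ 0 → G.eval x₀ = 0 := by
      intro x₀ hx
      have h := hcon ![x₀, P.eval x₀ / x₀] (hAval x₀ hx)
      simp only [Matrix.cons_val_zero, Matrix.cons_val_one] at h
      rw [hG]
      simp only [Polynomial.eval_sub, Polynomial.eval_add, Polynomial.eval_mul, Polynomial.eval_C,
        Polynomial.eval_pow, Polynomial.eval_X]
      have h' : (m 0 : ℂ) * x₀ * x₀ + (m 1 : ℂ) * P.eval x₀ = c * x₀ := by
        have := congrArg (fun u => u * x₀) h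
        rw [← this]
        field_simp
      linear_combination h'
    have hG0 : G = 0 := by
      apply Polynomial.eq_zero_of_infinite_isRoot
      refine ((Set.finite_singleton (0 : ℂ)).infinite_compl).mono fun x₀ hx => ?_
      exact hGroot x₀ hx
    have hm1 : m 1 = 0 := by
      have h := congrArg (fun q : Polynomial ℂ => q.coeff P.natDegree) hG0
      simp only [hG, Polynomial.coeff_sub, Polynomial.coeff_add, Polynomial.coeff_C_mul,
        Polynomial.coeff_X_pow, Polynomial.coeff_X, Polynomial.coeff_zero] at h
      rw [if_neg (by omega), if_neg (by omega)] at h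
      simp only [mul_zero, zero_add, sub_zero] at h
      rcases mul_eq_zero.1 h with h | h
      · exact_mod_cast h
      · exact absurd h hlc
    have hm0 : m 0 = 0 := by
      have h := congrArg (fun q : Polynomial ℂ => q.coeff 2) hG0
      simp only [hG, hm1, Int.cast_zero, map_zero, zero_mul, add_zero, Polynomial.coeff_sub,
        Polynomial.coeff_C_mul, Polynomial.coeff_X_pow, Polynomial.coeff_X, Polynomial.coeff_zero,
        if_true] at h
      norm_num at h
      exact_mod_cast h
    apply hm
    funext i
    fin_cases i
    · exact hm0
    · exact hm1

/-- **The family: case ∧ dense.**  For every `P ∈ ℂ[X]` of degree `≥ 3` with `P(0) ≠ 0` and every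
`θ ≠ 0`, the surface `{x₀x₁ − P(x₀) = 0, y₀ = x₁ − Q(x₀) + θ}` (`Q = (P − P(0))/X`) over the Laurent
graph `x₁ = P(x₀)/x₀` is in Mantova–Masser's case AND has Zariski-dense exponential points.
[cite: MantovaMasser2023, §1 Further remarks, p. 5 (the question, open in general)] (new) -/
theorem unprojectedDensityQuestion_laurentGraphFamily (hn : 3 ≤ P.natDegree) (h0 : P.coeff 0 ≠ 0)
    (hθ : θ ≠ 0) :
    MMCaseDimPiOneFree {w : Fin 2 ⊕ Fin 2 → ℂ |
        MvPolynomial.eval ![w (Sum.inl 0), w (Sum.inl 1)]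
          (X 0 * X 1 - Polynomial.aeval (X 0 : MvPolynomial (Fin 2) ℂ) P) = 0 ∧
        w (Sum.inr 0) = MvPolynomial.eval ![w (Sum.inl 0), w (Sum.inl 1)]
          (X 1 - Polynomial.aeval (X 0 : MvPolynomial (Fin 2) ℂ) (Polynomial.divX P) +
            MvPolynomial.C θ)} ∧
      UnprojectedDense {w : Fin 2 ⊕ Fin 2 → ℂ |
        MvPolynomial.eval ![w (Sum.inl 0), w (Sum.inl 1)]
          (X 0 * X 1 - Polynomial.aeval (X 0 : MvPolynomial (Fin 2) ℂ) P) = 0 ∧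
        w (Sum.inr 0) = MvPolynomial.eval ![w (Sum.inl 0), w (Sum.inl 1)]
          (X 1 - Polynomial.aeval (X 0 : MvPolynomial (Fin 2) ℂ) (Polynomial.divX P) +
            MvPolynomial.C θ)} :=
  ⟨mmCase_laurentGraphFamily P θ hn h0, unprojectedDense_laurentGraphFamily P θ hn h0 hθ⟩

/-- **Plain coordinates.**  `{x₀x₁ − P(x₀) = 0, y₀ = x₁ − Q(x₀) + θ}` is in the case AND dense.
[cite: MantovaMasser2023, §1 Further remarks, p. 5 (the question, open in general)] (new) -/
theorem unprojectedDensityQuestion_laurentGraphFamily' (hn : 3 ≤ P.natDegree) (h0 : P.coeff 0 ≠ 0)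
    (hθ : θ ≠ 0) :
    MMCaseDimPiOneFree {w : Fin 2 ⊕ Fin 2 → ℂ |
        w (Sum.inl 0) * w (Sum.inl 1) - P.eval (w (Sum.inl 0)) = 0 ∧
        w (Sum.inr 0) = w (Sum.inl 1) - (Polynomial.divX P).eval (w (Sum.inl 0)) + θ} ∧
      UnprojectedDense {w : Fin 2 ⊕ Fin 2 → ℂ |
        w (Sum.inl 0) * w (Sum.inl 1) - P.eval (w (Sum.inl 0)) = 0 ∧
        w (Sum.inr 0) = w (Sum.inl 1) - (Polynomial.divX P).eval (w (Sum.inl 0)) + θ} := by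
  have e : {w : Fin 2 ⊕ Fin 2 → ℂ |
        MvPolynomial.eval ![w (Sum.inl 0), w (Sum.inl 1)]
          (X 0 * X 1 - Polynomial.aeval (X 0 : MvPolynomial (Fin 2) ℂ) P) = 0 ∧
        w (Sum.inr 0) = MvPolynomial.eval ![w (Sum.inl 0), w (Sum.inl 1)]
          (X 1 - Polynomial.aeval (X 0 : MvPolynomial (Fin 2) ℂ) (Polynomial.divX P) +
            MvPolynomial.C θ)} =
      {w : Fin 2 ⊕ Fin 2 → ℂ | w (Sum.inl 0) * w (Sum.inl 1) - P.eval (w (Sum.inl 0)) = 0 ∧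
        w (Sum.inr 0) = w (Sum.inl 1) - (Polynomial.divX P).eval (w (Sum.inl 0)) + θ} := by
    ext w
    simp only [Set.mem_setOf_eq, eval_laurentFamily_baseMv, eval_laurentFamily_fibreMv,
      Matrix.cons_val_zero, Matrix.cons_val_one]
  have h := unprojectedDensityQuestion_laurentGraphFamily P θ hn h0 hθ
  rw [e] at h
  exact h

end Family

end Summit.Schanuel.Schanuel.Theorems
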